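import Literature.MathematicalPhysics.QuantumManyBody.NeumannMomentumCutoffs
import Mathlib.MeasureTheory.Group.Integral
import HarnessLib

/-!
# Symmetrisation by mirror images on the Neumann box: FGJMOT Lemma 2.5

Topic `Literature/MathematicalPhysics/QuantumManyBody`, grouping namespace `NeumannBox`
(provefact `Literature.MathematicalPhysics.QuantumManyBody.BoseGas.Junge2026_neumannBox_pinnedLowerBound`;
brick: [FournaisEtAl2024, §2.5 (2.19)–(2.22), Lemma 2.5], the mirroring technique of [HHNST]
making a radial pair potential commute with the Neumann momentum).

* `mirror ℓ z` — the mirror transformation (2.19) of `Λ = [0,ℓ]³`,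
  `(p_z(x))ᵢ = (-1)^{zᵢ}(xᵢ - ℓ/2) + ℓ/2 + ℓzᵢ`, `z ∈ ℤ³` (`p_z(Λ) = Λ + ℓz`), a measure
  preserving affine bijection of `ℝ³` under which the Neumann modes `u_p` (`mode ℓ p`, extended
  to `ℝ³` by their formula) are invariant (`mode_mirror`);
* `symmetrize ℓ f x y = f^s(x,y) = Σ_z f(p_z(x) - y)` — the symmetrisation (2.21), here summed
  over `z ∈ {-1,0,1}³`, which is the whole sum for `x, y ∈ Λ` when `supp f ⊆ B(0,R)`, `R < ℓ`
  (the only case in which it is used, `R ≤ ℓ/2`);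
* `FournaisEtAl2024_lemma25` — **Lemma 2.5**: for `f` radial, integrable, supported in `B(0,R)`,
  `R ≤ ℓ/2`, and `p, q ∈ (π/ℓ)ℕ₀³`,
  `∫_Λ∫_Λ f^s(x,y)u_p(x)u_q(y) dx dy = δ_{pq} ∫_{ℝ³} f(x)∏ᵢcos(pᵢxᵢ) dx` (`= δ_{pq} f̂(p)`,
  `fourier_eq_integral_prod_cos`). Proof: the images `p_z(Λ)`, `z ∈ {-1,0,1}³`, tile
  `[-ℓ,2ℓ]³ ⊇ Λ + B(0,R)` up to null faces, so by the invariance of `u_p` and a change of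
  variables `Σ_z∫_Λ f(p_z x - y)u_p(x)dx = ∫_{ℝ³} f(x - y)u_p(x)dx = ∫ f(w)u_p(w + y)dw`; averaging
  over the eight coordinate reflections (which fix the radial `f` and the measure),
  `u_p(w + y) ↦ ∏ᵢcos(pᵢwᵢ)·u_p(y)`, and the `y`-integral is the orthonormality of the modes.

## References

* [FournaisEtAl2024] S. Fournais, L. Junge, T. Girardot, L. Morin, M. Olivieri, A. Triay, *The free
  energy of dilute Bose gases at low temperatures interacting via strong potentials*,
  arXiv:2408.14222, Ann. Henri Poincaré (2026): §2.5, (2.19)–(2.22), Lemma 2.5.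
* [HHNST] F. Haberberger, C. Hainzl, P. T. Nam, R. Seiringer, A. Triay, *The free energy of
  dilute Bose gases at low temperatures*, arXiv:2304.02405 (the mirroring technique).
-/

noncomputable section

open Real MeasureTheory Set Finset
open scoped BigOperators

namespace Literature.MathematicalPhysics.QuantumManyBody.NeumannBox

open Literature.MathematicalPhysics.QuantumManyBody.BoseGas

/-! ### One-dimensional mirrors -/

section OneDim

variable {ℓ : ℝ}

/-- The one-dimensional mirror `t ↦ (-1)^z (t - ℓ/2) + ℓ/2 + ℓz` of `[0, ℓ]` (`z ∈ ℤ`): identity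
for `z = 0`, `t ↦ -t` for `z = -1`, `t ↦ 2ℓ - t` for `z = 1`; it maps `[0,ℓ]` onto `[ℓz, ℓ(z+1)]`.
[cite: FournaisEtAl2024, (2.19)] -/
def mirror₁ (ℓ : ℝ) (z : ℤ) (t : ℝ) : ℝ := (-1 : ℝ) ^ z * (t - ℓ / 2) + ℓ / 2 + ℓ * z

/-- The sign `(-1)^z` is `±1`. [folklore] -/
theorem neg_one_zpow_sq (z : ℤ) : ((-1 : ℝ) ^ z) * ((-1 : ℝ) ^ z) = 1 := by
  rw [← zpow_add₀ (by norm_num : (-1 : ℝ) ≠ 0), ← two_mul, zpow_mul]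
  norm_num

/-- `|(-1)^z| = 1`. [folklore] -/
theorem abs_neg_one_zpow (z : ℤ) : |((-1 : ℝ) ^ z)| = 1 := by
  rw [abs_zpow, abs_neg, abs_one, one_zpow]

/-- The inverse mirror. [folklore] -/
theorem mirror₁_inv (ℓ : ℝ) (z : ℤ) (t : ℝ) :
    mirror₁ ℓ z ((-1 : ℝ) ^ z * (t - ℓ / 2 - ℓ * z) + ℓ / 2) = t := by
  unfold mirror₁
  have h := neg_one_zpow_sq z
  linear_combination (t - ℓ / 2 - ℓ * z) * h

/-- The inverse mirror, other composition. [folklore] -/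
theorem inv_mirror₁ (ℓ : ℝ) (z : ℤ) (t : ℝ) :
    (-1 : ℝ) ^ z * (mirror₁ ℓ z t - ℓ / 2 - ℓ * z) + ℓ / 2 = t := by
  unfold mirror₁
  have h := neg_one_zpow_sq z
  linear_combination (t - ℓ / 2) * h

/-- The one-dimensional mirror as a measurable bijection of `ℝ`. [cite: FournaisEtAl2024, (2.19)] -/
def mirror₁Equiv (ℓ : ℝ) (z : ℤ) : ℝ ≃ᵐ ℝ where
  toFun := mirror₁ ℓ z
  invFun t := (-1 : ℝ) ^ z * (t - ℓ / 2 - ℓ * z) + ℓ / 2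
  left_inv t := inv_mirror₁ ℓ z t
  right_inv t := mirror₁_inv ℓ z t
  measurable_toFun := by
    show Measurable (mirror₁ ℓ z); unfold mirror₁; fun_prop
  measurable_invFun := by
    show Measurable fun t : ℝ => (-1 : ℝ) ^ z * (t - ℓ / 2 - ℓ * z) + ℓ / 2; fun_prop

/-- The bundled mirror acts as `mirror₁`. [folklore] -/
@[simp] theorem mirror₁Equiv_apply (ℓ : ℝ) (z : ℤ) (t : ℝ) : mirror₁Equiv ℓ z t = mirror₁ ℓ z t := rfl

/-- Multiplication by a number of modulus one preserves Lebesgue measure. [folklore] -/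
theorem measurePreserving_mul_left_of_abs {s : ℝ} (hs : |s| = 1) :
    MeasurePreserving (fun t : ℝ => s * t) volume volume := by
  have hs0 : s ≠ 0 := by intro h; rw [h, abs_zero] at hs; exact zero_ne_one hs
  refine ⟨measurable_const_mul s, ?_⟩
  rw [Real.map_volume_mul_left hs0, abs_inv, hs, inv_one, ENNReal.ofReal_one, one_smul]

/-- **The one-dimensional mirror preserves Lebesgue measure.** [cite: FournaisEtAl2024, (2.19)] -/
theorem measurePreserving_mirror₁ (ℓ : ℝ) (z : ℤ) : MeasurePreserving (mirror₁ ℓ z) volume volume := by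
  have h1 : MeasurePreserving (fun t : ℝ => t - ℓ / 2) volume volume := by
    simpa [sub_eq_add_neg] using measurePreserving_add_right volume (-(ℓ / 2))
  have h2 := measurePreserving_mul_left_of_abs (abs_neg_one_zpow z)
  have h3 : MeasurePreserving (fun t : ℝ => t + (ℓ / 2 + ℓ * z)) volume volume :=
    measurePreserving_add_right volume _
  have hfun : mirror₁ ℓ z = ((fun t : ℝ => t + (ℓ / 2 + ℓ * z)) ∘ fun t : ℝ => (-1 : ℝ) ^ z * t) ∘
      fun t : ℝ => t - ℓ / 2 := by
    funext t; simp only [mirror₁, Function.comp]; ring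
  rw [hfun]
  exact (h3.comp h2).comp h1

/-- **The Neumann cosines are invariant under the mirrors**: `cos(nπ·p_z(t)/ℓ) = cos(nπt/ℓ)`
(even and `2ℓ`-periodic). [cite: FournaisEtAl2024, §2.5 (after (2.21))] -/
theorem cos_waveNumber_mirror₁ (hℓ : ℓ ≠ 0) (n : ℕ) (z : ℤ) (t : ℝ) :
    Real.cos (waveNumber ℓ n * mirror₁ ℓ z t) = Real.cos (waveNumber ℓ n * t) := by
  unfold mirror₁
  rcases Int.even_or_odd z with ⟨m, hm⟩ | ⟨m, hm⟩
  · have hs : (-1 : ℝ) ^ z = 1 := by rw [hm, ← two_mul, zpow_mul]; norm_num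
    rw [hs]
    have : waveNumber ℓ n * (1 * (t - ℓ / 2) + ℓ / 2 + ℓ * z) =
        waveNumber ℓ n * t + ((n : ℤ) * m : ℤ) * (2 * π) := by
      rw [hm, waveNumber]; push_cast; field_simp; ring
    rw [this, Real.cos_add_int_mul_two_pi]
  · have hs : (-1 : ℝ) ^ z = -1 := by
      rw [hm, zpow_add₀ (by norm_num : (-1 : ℝ) ≠ 0), zpow_mul]; norm_num
    rw [hs]
    have : waveNumber ℓ n * (-1 * (t - ℓ / 2) + ℓ / 2 + ℓ * z) =
        -(waveNumber ℓ n * t) + ((n : ℤ) * (m + 1) : ℤ) * (2 * π) := by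
      rw [hm, waveNumber]; push_cast; field_simp; ring
    rw [this, Real.cos_add_int_mul_two_pi, Real.cos_neg]

/-- The cosine modes are invariant under the mirrors. [cite: FournaisEtAl2024, §2.5] -/
theorem cosMode_mirror₁ (hℓ : ℓ ≠ 0) (n : ℕ) (z : ℤ) (t : ℝ) :
    cosMode ℓ n (mirror₁ ℓ z t) = cosMode ℓ n t := by
  rw [cosMode, cosMode, cos_waveNumber_mirror₁ hℓ]

/-- `p_{-1}(t) = -t`. [cite: FournaisEtAl2024, (2.19)] -/
theorem mirror₁_neg_one (ℓ t : ℝ) : mirror₁ ℓ (-1) t = -t := by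
  rw [mirror₁, zpow_neg_one, inv_neg, inv_one]; push_cast; ring

/-- `p_0(t) = t`. [cite: FournaisEtAl2024, (2.19)] -/
theorem mirror₁_zero (ℓ t : ℝ) : mirror₁ ℓ 0 t = t := by
  rw [mirror₁, zpow_zero]; push_cast; ring

/-- `p_1(t) = 2ℓ - t`. [cite: FournaisEtAl2024, (2.19)] -/
theorem mirror₁_one (ℓ t : ℝ) : mirror₁ ℓ 1 t = 2 * ℓ - t := by
  rw [mirror₁, zpow_one]; push_cast; ring

end OneDim

/-! ### The mirror transformations of the box and the symmetrisation -/

section Mirror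

variable {ℓ : ℝ}

/-- The transfer between `ℝ³ = Space` and `Fin 3 → ℝ`. [folklore] -/
abbrev toCoords : Space ≃ᵐ (Fin 3 → ℝ) := (MeasurableEquiv.toLp 2 (Fin 3 → ℝ)).symm

/-- **The mirror transformation `p_z` of the box** `[0,ℓ]³`, `z ∈ ℤ³`:
`(p_z(x))ᵢ = (-1)^{zᵢ}(xᵢ - ℓ/2) + ℓ/2 + ℓzᵢ`. [cite: FournaisEtAl2024, (2.19)] -/
def mirror (ℓ : ℝ) (z : Fin 3 → ℤ) (x : Space) : Space :=
  toCoords.symm fun i => mirror₁ ℓ (z i) (x i)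

/-- Coordinates of the mirror image. [cite: FournaisEtAl2024, (2.19)] -/
@[simp] theorem mirror_apply (ℓ : ℝ) (z : Fin 3 → ℤ) (x : Space) (i : Fin 3) :
    mirror ℓ z x i = mirror₁ ℓ (z i) (x i) := rfl

/-- The mirror transformation as a measurable bijection of `ℝ³`. [cite: FournaisEtAl2024, (2.19)] -/
def mirrorEquiv (ℓ : ℝ) (z : Fin 3 → ℤ) : Space ≃ᵐ Space :=
  toCoords.trans ((MeasurableEquiv.piCongrRight fun i => mirror₁Equiv ℓ (z i)).trans toCoords.symm)

/-- The bundled mirror transformation acts as `mirror`. [folklore] -/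
theorem mirrorEquiv_apply (ℓ : ℝ) (z : Fin 3 → ℤ) (x : Space) : mirrorEquiv ℓ z x = mirror ℓ z x := rfl

/-- **The mirror transformations preserve Lebesgue measure on `ℝ³`.** [cite: FournaisEtAl2024, (2.19)] -/
theorem measurePreserving_mirror (ℓ : ℝ) (z : Fin 3 → ℤ) :
    MeasurePreserving (mirrorEquiv ℓ z) volume volume := by
  have h1 : MeasurePreserving (toCoords : Space ≃ᵐ (Fin 3 → ℝ)) volume volume :=
    EuclideanSpace.volume_preserving_symm_measurableEquiv_toLp (Fin 3)
  have h2 : MeasurePreserving (MeasurableEquiv.piCongrRight fun i => mirror₁Equiv ℓ (z i))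
      (volume : Measure (Fin 3 → ℝ)) volume := by
    have := volume_preserving_pi (fun i : Fin 3 => measurePreserving_mirror₁ ℓ (z i))
    exact this
  exact (h1.symm.comp h2).comp h1

/-- **The Neumann modes are invariant under the mirror transformations.**
[cite: FournaisEtAl2024, §2.5 (after (2.21))] -/
theorem mode_mirror (hℓ : ℓ ≠ 0) (k : Fin 3 → ℕ) (z : Fin 3 → ℤ) (x : Space) :
    mode ℓ k (mirror ℓ z x) = mode ℓ k x := by
  simp only [mode, mirror_apply, cosMode_mirror₁ hℓ]

/-- The index set `{-1, 0, 1}³` of the mirror images meeting a potential of range `< ℓ`.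
[cite: FournaisEtAl2024, (2.21)] -/
abbrev nearImages : Finset (Fin 3 → ℤ) := Fintype.piFinset fun _ => Finset.Icc (-1 : ℤ) 1

/-- **The symmetrisation `f^s(x,y) = Σ_z f(p_z(x) - y)`** of a function on `ℝ³`
[FournaisEtAl2024, (2.21)], summed over the images `z ∈ {-1,0,1}³` (for `x, y ∈ Λ` and
`supp f ⊆ B(0,R)` with `R < ℓ` these are all the non-zero terms of the sum over `ℤ³`).
[cite: FournaisEtAl2024, (2.21)] -/
def symmetrize (ℓ : ℝ) (f : Space → ℝ) (x y : Space) : ℝ :=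
  ∑ z ∈ nearImages, f (mirror ℓ z x - y)

end Mirror

/-! ### Coordinate reflections and the averaging identity -/

section Flip

variable {ℓ : ℝ}

/-- The admissible sign vectors `{1, -1}³`. [folklore] -/
abbrev signs : Finset (Fin 3 → ℝ) := Fintype.piFinset fun _ => ({1, -1} : Finset ℝ)

/-- The coordinate reflection `w ↦ (εᵢwᵢ)ᵢ`. [folklore] -/
def coordFlip (ε : Fin 3 → ℝ) (w : Space) : Space := toCoords.symm fun i => ε i * w i

/-- Coordinates of a reflected point. [folklore] -/
@[simp] theorem coordFlip_apply (ε : Fin 3 → ℝ) (w : Space) (i : Fin 3) : coordFlip ε w i = ε i * w i := rfl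

/-- The entries of a sign vector are `±1`. [folklore] -/
theorem mem_signs {ε : Fin 3 → ℝ} (hε : ε ∈ signs) (i : Fin 3) : ε i = 1 ∨ ε i = -1 := by
  have := Fintype.mem_piFinset.1 hε i
  simpa using this

/-- `εᵢ² = 1`. [folklore] -/
theorem sq_of_mem_signs {ε : Fin 3 → ℝ} (hε : ε ∈ signs) (i : Fin 3) : ε i * ε i = 1 := by
  rcases mem_signs hε i with h | h <;> rw [h] <;> norm_num

/-- `|εᵢ| = 1`. [folklore] -/
theorem abs_of_mem_signs {ε : Fin 3 → ℝ} (hε : ε ∈ signs) (i : Fin 3) : |ε i| = 1 := by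
  rcases mem_signs hε i with h | h <;> rw [h] <;> norm_num

/-- A coordinate reflection is an involution. [folklore] -/
theorem coordFlip_coordFlip {ε : Fin 3 → ℝ} (hε : ε ∈ signs) (w : Space) : coordFlip ε (coordFlip ε w) = w := by
  have : ∀ i, coordFlip ε (coordFlip ε w) i = w i := fun i => by
    rw [coordFlip_apply, coordFlip_apply, ← mul_assoc, sq_of_mem_signs hε, one_mul]
  exact (PiLp.ext this)

/-- A coordinate reflection preserves the norm. [folklore] -/
theorem norm_coordFlip {ε : Fin 3 → ℝ} (hε : ε ∈ signs) (w : Space) : ‖coordFlip ε w‖ = ‖w‖ := by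
  rw [EuclideanSpace.norm_eq, EuclideanSpace.norm_eq]
  congr 1
  refine Finset.sum_congr rfl fun i _ => ?_
  rw [coordFlip_apply, norm_mul, Real.norm_eq_abs, abs_of_mem_signs hε, one_mul]

/-- The coordinate reflection as a measurable bijection. [folklore] -/
def coordFlipEquiv {ε : Fin 3 → ℝ} (hε : ε ∈ signs) : Space ≃ᵐ Space where
  toFun := coordFlip ε
  invFun := coordFlip ε
  left_inv := coordFlip_coordFlip hε
  right_inv := coordFlip_coordFlip hε
  measurable_toFun := toCoords.symm.measurable.comp
    (measurable_pi_iff.2 fun i => (measurable_const.mul ((measurable_pi_apply i).comp toCoords.measurable)))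
  measurable_invFun := toCoords.symm.measurable.comp
    (measurable_pi_iff.2 fun i => (measurable_const.mul ((measurable_pi_apply i).comp toCoords.measurable)))

/-- **Coordinate reflections preserve Lebesgue measure.** [folklore] -/
theorem measurePreserving_coordFlip {ε : Fin 3 → ℝ} (hε : ε ∈ signs) :
    MeasurePreserving (coordFlipEquiv hε) volume volume := by
  have h1 : MeasurePreserving (toCoords : Space ≃ᵐ (Fin 3 → ℝ)) volume volume :=
    EuclideanSpace.volume_preserving_symm_measurableEquiv_toLp (Fin 3)
  have h2 : MeasurePreserving (fun (a : Fin 3 → ℝ) (i : Fin 3) => ε i * a i)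
      (volume : Measure (Fin 3 → ℝ)) volume :=
    volume_preserving_pi fun i : Fin 3 => measurePreserving_mul_left_of_abs (abs_of_mem_signs hε i)
  exact (h1.symm.comp h2).comp h1

/-- A radial function is invariant under the coordinate reflections. [folklore] -/
theorem radial_coordFlip {f : Space → ℝ} (hrad : ∀ x y : Space, ‖x‖ = ‖y‖ → f x = f y)
    {ε : Fin 3 → ℝ} (hε : ε ∈ signs) (w : Space) : f (coordFlip ε w) = f w :=
  hrad _ _ (norm_coordFlip hε w)

/-- `cos(a + b) + cos(-a + b) = 2 cos a cos b`. [folklore] -/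
theorem cos_add_add_cos_neg_add (a b : ℝ) :
    Real.cos (a + b) + Real.cos (-a + b) = 2 * (Real.cos a * Real.cos b) := by
  rw [Real.cos_add, show -a + b = b - a by ring, Real.cos_sub]; ring

/-- **The reflection-averaged translate of a mode factorises**:
`(1/8) Σ_ε u_k(εw + y) = ∏ᵢ cos(kᵢπwᵢ/ℓ) · u_k(y)`. [cite: FournaisEtAl2024, Lemma 2.5, proof] -/
theorem sum_signs_mode_coordFlip_add (ℓ : ℝ) (k : Fin 3 → ℕ) (w y : Space) :
    ∑ ε ∈ signs, mode ℓ k (coordFlip ε w + y) =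
      8 * ((∏ i, Real.cos (waveNumber ℓ (k i) * w i)) * mode ℓ k y) := by
  have hmode : ∀ ε : Fin 3 → ℝ, mode ℓ k (coordFlip ε w + y) = ∏ i, cosMode ℓ (k i) (ε i * w i + y i) := by
    intro ε; simp only [mode, PiLp.add_apply, coordFlip_apply]
  simp_rw [hmode]
  rw [← Finset.prod_univ_sum (fun _ => ({1, -1} : Finset ℝ)) (fun i s => cosMode ℓ (k i) (s * w i + y i))]
  have h1 : ∀ i : Fin 3, ∑ s ∈ ({1, -1} : Finset ℝ), cosMode ℓ (k i) (s * w i + y i) =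
      2 * (Real.cos (waveNumber ℓ (k i) * w i) * cosMode ℓ (k i) (y i)) := by
    intro i
    rw [Finset.sum_pair (by norm_num)]
    simp only [one_mul, neg_one_mul, cosMode]
    have e1 : waveNumber ℓ (k i) * (w i + y i) = waveNumber ℓ (k i) * w i + waveNumber ℓ (k i) * y i := by
      ring
    have e2 : waveNumber ℓ (k i) * (-w i + y i) = -(waveNumber ℓ (k i) * w i) + waveNumber ℓ (k i) * y i := by
      ring
    rw [e1, e2, ← mul_add, cos_add_add_cos_neg_add]
    ring
  simp_rw [h1]
  rw [Finset.prod_mul_distrib, Finset.prod_mul_distrib, Finset.prod_const, Finset.card_univ,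
    Fintype.card_fin, mode]
  norm_num

end Flip

/-! ### Bounds and integrability -/

section Bounds

variable {ℓ : ℝ}

/-- `|u_k(x)| ≤ (2/ℓ)^{3/2}`. [cite: FournaisEtAl2024, (2.20)] -/
theorem abs_mode_le (hℓ : 0 < ℓ) (k : Fin 3 → ℕ) (x : Space) :
    |mode ℓ k x| ≤ Real.sqrt (2 / ℓ) ^ 3 := by
  rw [mode, Finset.abs_prod]
  calc ∏ i, |cosMode ℓ (k i) (x i)| ≤ ∏ _i : Fin 3, Real.sqrt (2 / ℓ) :=
        Finset.prod_le_prod (fun i _ => abs_nonneg _) fun i _ => abs_cosMode_le hℓ (k i) (x i)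
    _ = Real.sqrt (2 / ℓ) ^ 3 := by rw [Finset.prod_const, Finset.card_univ, Fintype.card_fin]

/-- An integrable function times a translate of a mode is integrable. [folklore] -/
theorem integrable_mul_mode (hℓ : 0 < ℓ) {f : Space → ℝ} (hf : Integrable f) (k : Fin 3 → ℕ)
    (y : Space) : Integrable fun w : Space => f w * mode ℓ k (w + y) := by
  refine hf.mul_bdd (c := Real.sqrt (2 / ℓ) ^ 3) ?_ ?_
  · exact ((continuous_mode ℓ k).comp (continuous_id.add continuous_const)).aestronglyMeasurable
  · exact Filter.Eventually.of_forall fun w => by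
      rw [Real.norm_eq_abs]; exact abs_mode_le hℓ k _

end Bounds

/-! ### The translated integral: averaging over the coordinate reflections -/

section Translate

variable {ℓ : ℝ}

/-- The coordinate reflections are continuous. [folklore] -/
theorem continuous_coordFlip (ε : Fin 3 → ℝ) : Continuous (coordFlip ε) := by
  have h : coordFlip ε = fun w : Space => WithLp.toLp 2 (fun i => ε i * WithLp.ofLp w i) := rfl
  rw [h]
  exact (PiLp.continuous_toLp 2 _).comp
    (continuous_pi fun i => continuous_const.mul ((continuous_apply i).comp (PiLp.continuous_ofLp 2 _)))

/-- **`∫ f(w) u_k(w + y) dw = (∫ f(w) ∏ᵢ cos(kᵢπwᵢ/ℓ) dw) · u_k(y)`** for a radial integrable `f`: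
the integral is invariant under each of the eight coordinate reflections (which fix `f` and the
measure), and the average of `u_k(εw + y)` over them is `∏ᵢcos(kᵢπwᵢ/ℓ)·u_k(y)`.
[cite: FournaisEtAl2024, Lemma 2.5, proof] -/
theorem integral_mul_mode_add (hℓ : 0 < ℓ) {f : Space → ℝ} (hf : Integrable f)
    (hrad : ∀ x y : Space, ‖x‖ = ‖y‖ → f x = f y) (k : Fin 3 → ℕ) (y : Space) :
    ∫ w : Space, f w * mode ℓ k (w + y) =
      (∫ w : Space, f w * ∏ i, Real.cos (waveNumber ℓ (k i) * w i)) * mode ℓ k y := by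
  set I : ℝ := ∫ w : Space, f w * mode ℓ k (w + y) with hI
  -- invariance under each reflection
  have hinv : ∀ ε ∈ signs, I = ∫ w : Space, f w * mode ℓ k (coordFlip ε w + y) := by
    intro ε hε
    have h := (measurePreserving_coordFlip hε).integral_comp' (f := coordFlipEquiv hε)
      (fun w : Space => f w * mode ℓ k (w + y))
    rw [hI, ← h]
    refine integral_congr_ae (Filter.Eventually.of_forall fun w => ?_)
    show f (coordFlip ε w) * mode ℓ k (coordFlip ε w + y) = f w * mode ℓ k (coordFlip ε w + y)
    rw [radial_coordFlip hrad hε]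
  have hint : ∀ ε ∈ signs, Integrable fun w : Space => f w * mode ℓ k (coordFlip ε w + y) := by
    intro ε _
    refine hf.mul_bdd (c := Real.sqrt (2 / ℓ) ^ 3) ?_ ?_
    · exact ((continuous_mode ℓ k).comp ((continuous_coordFlip ε).add continuous_const)).aestronglyMeasurable
    · exact Filter.Eventually.of_forall fun w => by rw [Real.norm_eq_abs]; exact abs_mode_le hℓ k _
  have hcard : (signs.card : ℝ) = 8 := by
    rw [Fintype.card_piFinset]; norm_num
  -- average
  have hsum : (8 : ℝ) * I = 8 * ((∫ w : Space, f w * ∏ i, Real.cos (waveNumber ℓ (k i) * w i)) * mode ℓ k y) := by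
    calc (8 : ℝ) * I = ∑ ε ∈ signs, ∫ w : Space, f w * mode ℓ k (coordFlip ε w + y) := by
          rw [Finset.sum_congr rfl fun ε hε => (hinv ε hε).symm, Finset.sum_const, nsmul_eq_mul, hcard]
      _ = ∫ w : Space, ∑ ε ∈ signs, f w * mode ℓ k (coordFlip ε w + y) := (integral_finsetSum _ hint).symm
      _ = ∫ w : Space, f w * (8 * ((∏ i, Real.cos (waveNumber ℓ (k i) * w i)) * mode ℓ k y)) := by
          refine integral_congr_ae (Filter.Eventually.of_forall fun w => ?_)
          show ∑ ε ∈ signs, f w * mode ℓ k (coordFlip ε w + y) = _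
          rw [← Finset.mul_sum, sum_signs_mode_coordFlip_add]
      _ = 8 * ((∫ w : Space, f w * ∏ i, Real.cos (waveNumber ℓ (k i) * w i)) * mode ℓ k y) := by
          rw [← integral_mul_const, ← integral_const_mul]
          refine integral_congr_ae (Filter.Eventually.of_forall fun w => ?_)
          show f w * (8 * ((∏ i, Real.cos (waveNumber ℓ (k i) * w i)) * mode ℓ k y)) = _
          ring
  linarith

end Translate

/-! ### The images of the cell tile its neighbourhood -/

section Tiling

variable {ℓ : ℝ}

/-- Change of variables by a mirror transformation on the cell. [cite: FournaisEtAl2024, Lemma 2.5, proof] -/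
theorem setIntegral_cell_comp_mirror (z : Fin 3 → ℤ) (F : Space → ℝ) :
    ∫ x in cell ℓ, F (mirror ℓ z x) = ∫ x in mirror ℓ z '' cell ℓ, F x := by
  have h := (measurePreserving_mirror ℓ z).setIntegral_preimage_emb (mirrorEquiv ℓ z).measurableEmbedding
    F (mirror ℓ z '' cell ℓ)
  have himg : mirror ℓ z '' cell ℓ = ⇑(mirrorEquiv ℓ z) '' cell ℓ := rfl
  have hpre : ⇑(mirrorEquiv ℓ z) ⁻¹' (mirror ℓ z '' cell ℓ) = cell ℓ := by
    rw [himg]; exact (mirrorEquiv ℓ z).injective.preimage_image _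
  rw [hpre] at h
  simpa only [mirrorEquiv_apply] using h

/-- Coordinates of the inverse mirror image. [cite: FournaisEtAl2024, (2.19)] -/
theorem mirrorEquiv_symm_apply (ℓ : ℝ) (z : Fin 3 → ℤ) (x : Space) (i : Fin 3) :
    (mirrorEquiv ℓ z).symm x i = (-1 : ℝ) ^ (z i) * (x i - ℓ / 2 - ℓ * z i) + ℓ / 2 := rfl

/-- Membership in an image of the cell. [cite: FournaisEtAl2024, (2.19)] -/
theorem mem_image_cell_iff (z : Fin 3 → ℤ) (x : Space) :
    x ∈ mirror ℓ z '' cell ℓ ↔ ∀ i, (-1 : ℝ) ^ (z i) * (x i - ℓ / 2 - ℓ * z i) + ℓ / 2 ∈ Ico 0 ℓ := by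
  have hiff : x ∈ mirror ℓ z '' cell ℓ ↔ (mirrorEquiv ℓ z).symm x ∈ cell ℓ := by
    constructor
    · rintro ⟨w, hw, rfl⟩
      rw [← mirrorEquiv_apply, (mirrorEquiv ℓ z).symm_apply_apply]
      exact hw
    · intro h
      exact ⟨(mirrorEquiv ℓ z).symm x, h, by rw [← mirrorEquiv_apply, (mirrorEquiv ℓ z).apply_symm_apply]⟩
  rw [hiff]
  simp only [cell, mem_setOf_eq, mirrorEquiv_symm_apply]

/-- The selector of the image containing a given coordinate. [folklore] -/
def imageIndex (ℓ : ℝ) (t : ℝ) : ℤ := if t < 0 then -1 else if t < ℓ then 0 else 1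

/-- The selected index lies in `{-1, 0, 1}`. [folklore] -/
theorem imageIndex_mem (ℓ t : ℝ) : imageIndex ℓ t ∈ Finset.Icc (-1 : ℤ) 1 := by
  unfold imageIndex; split_ifs <;> decide

/-- A point of `[-ℓ/2, 3ℓ/2]³` off the faces lies in the image selected by `imageIndex`.
[cite: FournaisEtAl2024, Lemma 2.5, proof] -/
theorem mem_image_imageIndex {x : Space} (hx : ∀ i, -(ℓ / 2) ≤ x i ∧ x i ≤ 3 * ℓ / 2)
    (hℓ' : ∀ i, x i ≠ ℓ) :
    x ∈ mirror ℓ (fun i => imageIndex ℓ (x i)) '' cell ℓ := by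
  rw [mem_image_cell_iff]
  intro i
  obtain ⟨h1, h2⟩ := hx i
  simp only [imageIndex]
  split_ifs with ha hb
  · rw [zpow_neg_one, inv_neg, inv_one]; push_cast
    simp only [Set.mem_Ico]
    constructor <;> linarith
  · rw [zpow_zero]; push_cast
    have : 0 ≤ x i := not_lt.1 ha
    simp only [Set.mem_Ico]
    constructor <;> linarith
  · rw [zpow_one]; push_cast
    have : ℓ < x i := lt_of_le_of_ne (not_lt.1 hb) (hℓ' i).symm
    simp only [Set.mem_Ico]
    constructor <;> linarith

/-- Off the faces, the image containing a point is unique among `z ∈ {-1,0,1}³`.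
[cite: FournaisEtAl2024, Lemma 2.5, proof] -/
theorem eq_imageIndex_of_mem_image (hℓ : 0 < ℓ) {x : Space} (h0 : ∀ i, x i ≠ 0)
    {z : Fin 3 → ℤ} (hz : z ∈ nearImages) (hx : x ∈ mirror ℓ z '' cell ℓ) :
    z = fun i => imageIndex ℓ (x i) := by
  rw [mem_image_cell_iff] at hx
  funext i
  have hzi : z i ∈ Finset.Icc (-1 : ℤ) 1 := Fintype.mem_piFinset.1 hz i
  obtain ⟨h1, h2⟩ := hx i
  simp only [imageIndex]
  have hcases : z i = -1 ∨ z i = 0 ∨ z i = 1 := by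
    have := Finset.mem_Icc.1 hzi; omega
  rcases hcases with h | h | h <;> rw [h] at h1 h2 ⊢
  · rw [zpow_neg_one, inv_neg, inv_one] at h1 h2; push_cast at h1 h2
    have : x i < 0 := by
      rcases lt_or_ge (x i) 0 with hl | hl
      · exact hl
      · exfalso; have := h0 i; nlinarith [lt_of_le_of_ne hl (h0 i).symm]
    rw [if_pos this]
  · rw [zpow_zero] at h1 h2; push_cast at h1 h2
    rw [if_neg (by linarith), if_pos (by linarith)]
  · rw [zpow_one] at h1 h2; push_cast at h1 h2
    rw [if_neg (by linarith), if_neg (by linarith)]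

/-- The faces `{xᵢ = c}` are null. [folklore] -/
theorem volume_coord_eq_zero (i : Fin 3) (c : ℝ) : volume {x : Space | x i = c} = 0 := by
  have h1 : MeasurePreserving (toCoords : Space ≃ᵐ (Fin 3 → ℝ)) volume volume :=
    EuclideanSpace.volume_preserving_symm_measurableEquiv_toLp (Fin 3)
  have hset : {x : Space | x i = c} = toCoords ⁻¹' {a : Fin 3 → ℝ | a i = c} := rfl
  rw [hset, h1.measure_preimage (MeasurableSet.nullMeasurableSet ?_)]
  · rw [volume_pi]; exact Measure.pi_hyperplane (fun _ : Fin 3 => (volume : Measure ℝ)) i c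
  · exact measurableSet_eq_fun (measurable_pi_apply i) measurable_const

/-- **The images `p_z(Λ)`, `z ∈ {-1,0,1}³`, tile `Λ + B(0, ℓ/2)`**: for `y ∈ Λ` and `f` vanishing
outside the ball of radius `R ≤ ℓ/2`, `Σ_z ∫_{p_z(Λ)} f(x - y)G(x) dx = ∫_{ℝ³} f(x - y)G(x) dx`.
[cite: FournaisEtAl2024, Lemma 2.5, proof] -/
theorem sum_setIntegral_images (hℓ : 0 < ℓ) {f : Space → ℝ} {R : ℝ}
    (hsupp : ∀ x, R < ‖x‖ → f x = 0) (hR : R ≤ ℓ / 2) {y : Space} (hy : y ∈ cell ℓ) (G : Space → ℝ)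
    (hint : Integrable fun x => f (x - y) * G x) :
    ∑ z ∈ nearImages, ∫ x in mirror ℓ z '' cell ℓ, f (x - y) * G x = ∫ x, f (x - y) * G x := by
  have hmeas : ∀ z, MeasurableSet (mirror ℓ z '' cell ℓ) := fun z =>
    (mirrorEquiv ℓ z).measurableEmbedding.measurableSet_image.2 (measurableSet_cell ℓ)
  set H : Space → ℝ := fun x => f (x - y) * G x with hH
  calc ∑ z ∈ nearImages, ∫ x in mirror ℓ z '' cell ℓ, H x
      = ∑ z ∈ nearImages, ∫ x, (mirror ℓ z '' cell ℓ).indicator H x := by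
        refine Finset.sum_congr rfl fun z _ => (integral_indicator (hmeas z)).symm
    _ = ∫ x, ∑ z ∈ nearImages, (mirror ℓ z '' cell ℓ).indicator H x :=
        (integral_finsetSum _ fun z _ => hint.indicator (hmeas z)).symm
    _ = ∫ x, H x := by
        refine integral_congr_ae ?_
        -- off the null faces the sum has exactly one non-zero term (or `H = 0`)
        have hnull : volume {x : Space | ∃ i, x i = 0 ∨ x i = ℓ} = 0 := by
          have : {x : Space | ∃ i, x i = 0 ∨ x i = ℓ} = ⋃ i, ({x : Space | x i = 0} ∪ {x | x i = ℓ}) := by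
            ext x; simp
          rw [this]
          refine measure_iUnion_null fun i => ?_
          rw [measure_union_null_iff]
          exact ⟨volume_coord_eq_zero i 0, volume_coord_eq_zero i ℓ⟩
        filter_upwards [compl_mem_ae_iff.2 hnull] with x hx
        simp only [mem_compl_iff, mem_setOf_eq, not_exists, not_or] at hx
        by_cases hH0 : H x = 0
        · rw [hH0]; exact Finset.sum_eq_zero fun z _ => by simp [hH0]
        -- `f(x - y) ≠ 0`, so `x` is within `ℓ/2` of `y ∈ Λ` in each coordinate
        have hfx : f (x - y) ≠ 0 := by
          intro h; apply hH0
          show f (x - y) * G x = 0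
          rw [h, zero_mul]
        have hxy : ‖x - y‖ ≤ R := not_lt.1 fun h => hfx (hsupp _ h)
        have hcoord : ∀ i, -(ℓ / 2) ≤ x i ∧ x i ≤ 3 * ℓ / 2 := by
          intro i
          have h1 : |(x - y) i| ≤ ‖x - y‖ := by
            rw [← Real.norm_eq_abs]; exact PiLp.norm_apply_le (x - y) i
          rw [PiLp.sub_apply, abs_le] at h1
          obtain ⟨hy1, hy2⟩ := hy i
          constructor <;> linarith
        set z₀ : Fin 3 → ℤ := fun i => imageIndex ℓ (x i) with hz₀
        have hz₀mem : z₀ ∈ nearImages := Fintype.mem_piFinset.2 fun i => imageIndex_mem ℓ (x i)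
        have hxz₀ : x ∈ mirror ℓ z₀ '' cell ℓ := mem_image_imageIndex hcoord fun i => (hx i).2
        rw [Finset.sum_eq_single_of_mem z₀ hz₀mem]
        · rw [Set.indicator_of_mem hxz₀]
        · intro z hz hzne
          rw [Set.indicator_of_notMem]
          intro hxz
          exact hzne (eq_imageIndex_of_mem_image hℓ (fun i => (hx i).1) hz hxz)

end Tiling

/-! ### Lemma 2.5 -/

section Lemma25

variable {ℓ : ℝ}

/-- A mirror-translate of an integrable function is integrable on the cell against a mode.
[folklore] -/
theorem integrableOn_mirror_term (hℓ : 0 < ℓ) {f : Space → ℝ} (hf : Integrable f) (z : Fin 3 → ℤ)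
    (k : Fin 3 → ℕ) (y : Space) :
    IntegrableOn (fun x : Space => f (mirror ℓ z x - y) * mode ℓ k x) (cell ℓ) := by
  have h1 : Integrable (fun x : Space => f (mirror ℓ z x - y)) := by
    have hsub : Integrable (fun x : Space => f (x - y)) := hf.comp_sub_right y
    have := (measurePreserving_mirror ℓ z).integrable_comp_emb (mirrorEquiv ℓ z).measurableEmbedding
      (g := fun x : Space => f (x - y))
    exact this.2 hsub
  refine (h1.mul_bdd (c := Real.sqrt (2 / ℓ) ^ 3) (continuous_mode ℓ k).aestronglyMeasurable
    (Filter.Eventually.of_forall fun x => ?_)).integrableOn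
  rw [Real.norm_eq_abs]; exact abs_mode_le hℓ k x

/-- **The `x`-integral of Lemma 2.5**: for `y ∈ Λ`,
`∫_Λ f^s(x,y) u_p(x) dx = (∫_{ℝ³} f(w)∏ᵢcos(pᵢwᵢ) dw) · u_p(y)`.
[cite: FournaisEtAl2024, Lemma 2.5, proof] -/
theorem setIntegral_symmetrize_mul_mode (hℓ : 0 < ℓ) {f : Space → ℝ} (hf : Integrable f)
    (hrad : ∀ x y : Space, ‖x‖ = ‖y‖ → f x = f y) {R : ℝ} (hsupp : ∀ x, R < ‖x‖ → f x = 0)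
    (hR : R ≤ ℓ / 2) (p : Fin 3 → ℕ) {y : Space} (hy : y ∈ cell ℓ) :
    ∫ x in cell ℓ, symmetrize ℓ f x y * mode ℓ p x =
      (∫ w : Space, f w * ∏ i, Real.cos (waveNumber ℓ (p i) * w i)) * mode ℓ p y := by
  have hℓ0 : ℓ ≠ 0 := hℓ.ne'
  calc ∫ x in cell ℓ, symmetrize ℓ f x y * mode ℓ p x
      = ∫ x in cell ℓ, ∑ z ∈ nearImages, f (mirror ℓ z x - y) * mode ℓ p x := by
        refine setIntegral_congr_fun (measurableSet_cell ℓ) fun x _ => ?_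
        rw [symmetrize, Finset.sum_mul]
    _ = ∑ z ∈ nearImages, ∫ x in cell ℓ, f (mirror ℓ z x - y) * mode ℓ p x :=
        integral_finsetSum _ fun z _ => integrableOn_mirror_term hℓ hf z p y
    _ = ∑ z ∈ nearImages, ∫ x in mirror ℓ z '' cell ℓ, f (x - y) * mode ℓ p x := by
        refine Finset.sum_congr rfl fun z _ => ?_
        rw [← setIntegral_cell_comp_mirror z (fun x => f (x - y) * mode ℓ p x)]
        refine setIntegral_congr_fun (measurableSet_cell ℓ) fun x _ => ?_
        simp only [mode_mirror hℓ0]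
    _ = ∫ x : Space, f (x - y) * mode ℓ p x :=
        sum_setIntegral_images hℓ hsupp hR hy (mode ℓ p) (by
          have h := integrable_mul_mode hℓ (hf.comp_sub_right y) p 0
          simpa using h)
    _ = ∫ w : Space, f w * mode ℓ p (w + y) := by
        rw [← integral_sub_right_eq_self (fun w : Space => f w * mode ℓ p (w + y)) y]
        simp only [sub_add_cancel]
    _ = _ := integral_mul_mode_add hℓ hf hrad p y

/-- **FGJMOT Lemma 2.5 (symmetrisation commutes with the Neumann basis).** Let `f : ℝ³ → ℝ` be
radial and integrable with `supp f ⊆ B(0, R)`, `R ≤ ℓ/2`. Then for all Neumann momenta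
`p, q ∈ (π/ℓ)ℕ₀³` (indexed by `ℕ₀³`),
`∫_{Λ²} f^s(x,y) u_p(x) u_q(y) dx dy = δ_{p,q} ∫_{ℝ³} f(x) ∏ᵢ cos(pᵢxᵢ) dx` (`= δ_{p,q} f̂(p)`,
`fourier_eq_integral_prod_cos`), `Λ = [0,ℓ)³` (`cell ℓ`), `u_p = mode ℓ p`, `f^s = symmetrize ℓ f`.
[cite: FournaisEtAl2024, Lemma 2.5, (2.22)] -/
theorem FournaisEtAl2024_lemma25 (hℓ : 0 < ℓ) {f : Space → ℝ} (hf : Integrable f)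
    (hrad : ∀ x y : Space, ‖x‖ = ‖y‖ → f x = f y) {R : ℝ} (hsupp : ∀ x, R < ‖x‖ → f x = 0)
    (hR : R ≤ ℓ / 2) (p q : Fin 3 → ℕ) :
    ∫ y in cell ℓ, (∫ x in cell ℓ, symmetrize ℓ f x y * mode ℓ p x) * mode ℓ q y =
      if p = q then ∫ x : Space, f x * ∏ i, Real.cos (waveNumber ℓ (p i) * x i) else 0 := by
  calc ∫ y in cell ℓ, (∫ x in cell ℓ, symmetrize ℓ f x y * mode ℓ p x) * mode ℓ q y
      = ∫ y in cell ℓ, (∫ w : Space, f w * ∏ i, Real.cos (waveNumber ℓ (p i) * w i)) *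
          (mode ℓ p y * mode ℓ q y) := by
        refine setIntegral_congr_fun (measurableSet_cell ℓ) fun y hy => ?_
        rw [setIntegral_symmetrize_mul_mode hℓ hf hrad hsupp hR p hy, mul_assoc]
    _ = (∫ w : Space, f w * ∏ i, Real.cos (waveNumber ℓ (p i) * w i)) *
          ∫ y in cell ℓ, mode ℓ p y * mode ℓ q y := integral_const_mul _ _
    _ = _ := by rw [setIntegral_cell_mode_mul_mode hℓ]; split_ifs <;> simp

/-- **The cosine integral is the Fourier transform**: for radial integrable `f` and the Neumann
momentum `p` (vector `(pᵢπ/ℓ)ᵢ`), `∫ f(x)e^{-ip·x} dx = ∫ f(x)∏ᵢcos(pᵢxᵢ) dx` (average the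
exponential over the coordinate reflections: `½(e^{-it} + e^{it}) = cos t`).
[cite: FournaisEtAl2024, Lemma 2.5, (2.22) (`= δ_{p,q} f̂(p)`)] -/
theorem fourier_eq_integral_prod_cos {f : Space → ℝ} (hf : Integrable f)
    (hrad : ∀ x y : Space, ‖x‖ = ‖y‖ → f x = f y) (p : Fin 3 → ℕ) :
    ∫ x : Space, (f x : ℂ) * Complex.exp (-(∑ i, (waveNumber ℓ (p i) * x i : ℝ) : ℂ) * Complex.I) =
      ((∫ x : Space, f x * ∏ i, Real.cos (waveNumber ℓ (p i) * x i) : ℝ) : ℂ) := by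
  set E : Space → ℂ := fun x => Complex.exp (-(∑ i, (waveNumber ℓ (p i) * x i : ℝ) : ℂ) * Complex.I) with hE
  have hEprod : ∀ x : Space, E x = ∏ i, Complex.exp (-((waveNumber ℓ (p i) * x i : ℝ) : ℂ) * Complex.I) := by
    intro x
    rw [hE]; dsimp only
    rw [← Complex.exp_sum]
    congr 1
    rw [← Finset.sum_neg_distrib, Finset.sum_mul]
  have hS : Continuous fun x : Space => ∑ i, ((waveNumber ℓ (p i) * x i : ℝ) : ℂ) :=
    continuous_finsetSum _ fun i _ => Complex.continuous_ofReal.comp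
      (continuous_const.mul ((continuous_apply i).comp (PiLp.continuous_ofLp 2 (fun _ : Fin 3 => ℝ))))
  have hEcont : Continuous E := by
    rw [hE]; exact Complex.continuous_exp.comp (hS.neg.mul continuous_const)
  have hEnorm : ∀ x, ‖E x‖ = 1 := fun x => by
    rw [hE]; dsimp only
    rw [show (-∑ i, ((waveNumber ℓ (p i) * x i : ℝ) : ℂ)) * Complex.I =
      ((-(∑ i, waveNumber ℓ (p i) * x i) : ℝ) : ℂ) * Complex.I by push_cast; ring,
      Complex.norm_exp_ofReal_mul_I]
  set I : ℂ := ∫ x : Space, (f x : ℂ) * E x with hI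
  have hintE : ∀ ε ∈ signs, Integrable fun x : Space => (f x : ℂ) * E (coordFlip ε x) := by
    intro ε _
    refine hf.ofReal.mul_bdd (c := 1) (hEcont.comp (continuous_coordFlip ε)).aestronglyMeasurable ?_
    exact Filter.Eventually.of_forall fun x => (hEnorm _).le
  have hinv : ∀ ε ∈ signs, I = ∫ x : Space, (f x : ℂ) * E (coordFlip ε x) := by
    intro ε hε
    have h := (measurePreserving_coordFlip hε).integral_comp' (f := coordFlipEquiv hε) (fun x : Space => (f x : ℂ) * E x)
    rw [hI, ← h]
    refine integral_congr_ae (Filter.Eventually.of_forall fun x => ?_)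
    show (f (coordFlip ε x) : ℂ) * E (coordFlip ε x) = (f x : ℂ) * E (coordFlip ε x)
    rw [radial_coordFlip hrad hε]
  have hcard : (signs.card : ℂ) = 8 := by rw [Fintype.card_piFinset]; norm_num
  -- the average of `E(εx)` over the reflections is `∏ cos`
  have havg : ∀ x : Space, ∑ ε ∈ signs, E (coordFlip ε x) =
      8 * ((∏ i, Real.cos (waveNumber ℓ (p i) * x i) : ℝ) : ℂ) := by
    intro x
    have h1 : ∀ ε : Fin 3 → ℝ, E (coordFlip ε x) =
        ∏ i, Complex.exp (-((waveNumber ℓ (p i) * (ε i * x i) : ℝ) : ℂ) * Complex.I) := by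
      intro ε; rw [hEprod]; rfl
    simp_rw [h1]
    rw [← Finset.prod_univ_sum (fun _ => ({1, -1} : Finset ℝ))
      (fun i s => Complex.exp (-((waveNumber ℓ (p i) * (s * x i) : ℝ) : ℂ) * Complex.I))]
    have h2 : ∀ i : Fin 3, ∑ s ∈ ({1, -1} : Finset ℝ),
        Complex.exp (-((waveNumber ℓ (p i) * (s * x i) : ℝ) : ℂ) * Complex.I) =
        2 * (Real.cos (waveNumber ℓ (p i) * x i) : ℂ) := by
      intro i
      rw [Finset.sum_pair (by norm_num)]
      simp only [one_mul, neg_one_mul, mul_neg]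
      rw [show -((waveNumber ℓ (p i) * x i : ℝ) : ℂ) * Complex.I =
          ((-(waveNumber ℓ (p i) * x i) : ℝ) : ℂ) * Complex.I by push_cast; ring,
        show -((-(waveNumber ℓ (p i) * x i) : ℝ) : ℂ) * Complex.I =
          ((waveNumber ℓ (p i) * x i : ℝ) : ℂ) * Complex.I by push_cast; ring,
        Complex.exp_mul_I, Complex.exp_mul_I, ← Complex.ofReal_cos, ← Complex.ofReal_sin,
        ← Complex.ofReal_cos, ← Complex.ofReal_sin, Real.cos_neg, Real.sin_neg]
      push_cast; ring
    simp_rw [h2]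
    rw [Finset.prod_mul_distrib, Finset.prod_const, Finset.card_univ, Fintype.card_fin]
    push_cast; ring
  have hsum : (8 : ℂ) * I = 8 * ((∫ x : Space, f x * ∏ i, Real.cos (waveNumber ℓ (p i) * x i) : ℝ) : ℂ) := by
    calc (8 : ℂ) * I = ∑ ε ∈ signs, ∫ x : Space, (f x : ℂ) * E (coordFlip ε x) := by
          rw [Finset.sum_congr rfl fun ε hε => (hinv ε hε).symm, Finset.sum_const, nsmul_eq_mul, hcard]
      _ = ∫ x : Space, ∑ ε ∈ signs, (f x : ℂ) * E (coordFlip ε x) := (integral_finsetSum _ hintE).symm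
      _ = ∫ x : Space, (f x : ℂ) * (8 * ((∏ i, Real.cos (waveNumber ℓ (p i) * x i) : ℝ) : ℂ)) := by
          refine integral_congr_ae (Filter.Eventually.of_forall fun x => ?_)
          show ∑ ε ∈ signs, (f x : ℂ) * E (coordFlip ε x) = _
          rw [← Finset.mul_sum, havg]
      _ = 8 * ((∫ x : Space, f x * ∏ i, Real.cos (waveNumber ℓ (p i) * x i) : ℝ) : ℂ) := by
          rw [← integral_complex_ofReal, ← integral_const_mul]
          refine integral_congr_ae (Filter.Eventually.of_forall fun x => ?_)
          show (f x : ℂ) * (8 * ((∏ i, Real.cos (waveNumber ℓ (p i) * x i) : ℝ) : ℂ)) = _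
          push_cast; ring
  have h8 : (8 : ℂ) ≠ 0 := by norm_num
  exact mul_left_cancel₀ h8 hsum

end Lemma25

/-! ### The product rule of the Neumann modes and the matrix element of `Q₃^{sym}` -/

section ProductRule

variable {ℓ : ℝ}

/-- `cos(|k|c) = cos(kc)`. [folklore] -/
theorem cos_abs_int_mul (k : ℤ) (c : ℝ) : Real.cos (|(k : ℝ)| * c) = Real.cos (k * c) := by
  rcases le_or_gt 0 (k : ℝ) with h | h
  · rw [abs_of_nonneg h]
  · rw [abs_of_neg h, neg_mul, Real.cos_neg]

/-- The wave number of `|m - n|`. [folklore] -/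
theorem waveNumber_natAbs_mul (ℓ : ℝ) (m n : ℕ) (t : ℝ) :
    Real.cos (waveNumber ℓ (Int.natAbs ((m : ℤ) - n)) * t) = Real.cos (waveNumber ℓ m * t - waveNumber ℓ n * t) := by
  have h1 : waveNumber ℓ (Int.natAbs ((m : ℤ) - n)) * t = |(((m : ℤ) - n : ℤ) : ℝ)| * (Real.pi / ℓ * t) := by
    rw [waveNumber, Nat.cast_natAbs, Int.cast_abs]; ring
  have h2 : waveNumber ℓ m * t - waveNumber ℓ n * t = (((m : ℤ) - n : ℤ) : ℝ) * (Real.pi / ℓ * t) := by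
    rw [waveNumber, waveNumber]; push_cast; ring
  rw [h1, h2, cos_abs_int_mul]

/-- `cos(mπt/ℓ)cos(nπt/ℓ) = ½(cos((m+n)πt/ℓ) + cos(|m-n|πt/ℓ))`.
[cite: FournaisEtAl2024, §6.1 ("using the trigonometric formulas")] -/
theorem cos_waveNumber_mul_cos_waveNumber (ℓ : ℝ) (m n : ℕ) (t : ℝ) :
    Real.cos (waveNumber ℓ m * t) * Real.cos (waveNumber ℓ n * t) =
      (Real.cos (waveNumber ℓ (m + n) * t) + Real.cos (waveNumber ℓ (Int.natAbs ((m : ℤ) - n)) * t)) / 2 := by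
  rw [waveNumber_natAbs_mul, show waveNumber ℓ (m + n) * t = waveNumber ℓ m * t + waveNumber ℓ n * t by
    rw [waveNumber, waveNumber, waveNumber]; push_cast; ring, Real.cos_add, Real.cos_sub]
  ring

/-- `e_j / c_j = ℓ^{-1/2} cos(jπt/ℓ)`. [cite: FournaisEtAl2024, (2.20)] -/
theorem cosMode_div_cosCoeff (ℓ : ℝ) (j : ℕ) (t : ℝ) :
    cosMode ℓ j t / cosCoeff j = Real.cos (waveNumber ℓ j * t) / Real.sqrt ℓ := by
  rw [cosMode]
  have := (cosCoeff_pos j).ne'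
  field_simp

/-- **The product rule of the Neumann cosine modes**:
`e_m(t)e_n(t) = (c_mc_n/(2√ℓ))(e_{m+n}(t)/c_{m+n} + e_{|m-n|}(t)/c_{|m-n|})`.
[cite: FournaisEtAl2024, §6.1 (the display for `u_p(y)u_s(y)`)] -/
theorem cosMode_mul_cosMode (hℓ : 0 < ℓ) (m n : ℕ) (t : ℝ) :
    cosMode ℓ m t * cosMode ℓ n t = cosCoeff m * cosCoeff n / (2 * Real.sqrt ℓ) *
      (cosMode ℓ (m + n) t / cosCoeff (m + n) +
        cosMode ℓ (Int.natAbs ((m : ℤ) - n)) t / cosCoeff (Int.natAbs ((m : ℤ) - n))) := by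
  rw [cosMode_div_cosCoeff, cosMode_div_cosCoeff, cosMode, cosMode]
  have hs : Real.sqrt ℓ ≠ 0 := (Real.sqrt_pos.2 hℓ).ne'
  rw [show cosCoeff m / Real.sqrt ℓ * Real.cos (waveNumber ℓ m * t) * (cosCoeff n / Real.sqrt ℓ * Real.cos (waveNumber ℓ n * t)) =
    cosCoeff m * cosCoeff n / (Real.sqrt ℓ * Real.sqrt ℓ) * (Real.cos (waveNumber ℓ m * t) * Real.cos (waveNumber ℓ n * t)) by
    field_simp, cos_waveNumber_mul_cos_waveNumber]
  field_simp

/-- The `σ`-shifted index `|p + σs| ∈ ℕ₀³` (`σ ∈ {±1}³`; `u_{-k} = u_k`). [cite: FournaisEtAl2024, §6.1 ("using the convention a_p = a_{(|p₁|,|p₂|,|p₃|)}")] -/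
theorem natAbs_index_one (p s : ℕ) : Int.natAbs ((p : ℤ) + 1 * s) = p + s := by
  rw [one_mul]; norm_cast

/-- **The product rule of the Neumann modes of the box**:
`u_p(y)u_s(y) = ∏ᵢ(c_{pᵢ}c_{sᵢ}/(2√ℓ)) Σ_{σ∈{±1}³} u_{|p+σs|}(y)/∏ᵢc_{|pᵢ+σᵢsᵢ|}`
(`= (2³|Λ|^{1/2})⁻¹∏c_{pᵢ}c_{sᵢ} Σ_σ u_{p+σs}/c_{p+σs}` with `u_{-k} = u_k`).
[cite: FournaisEtAl2024, §6.1 (the display for `u_p(y)u_s(y)`)] -/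
theorem mode_mul_mode (hℓ : 0 < ℓ) (p s : Fin 3 → ℕ) (y : Space) :
    mode ℓ p y * mode ℓ s y = (∏ i, cosCoeff (p i) * cosCoeff (s i) / (2 * Real.sqrt ℓ)) *
      ∑ σ ∈ Fintype.piFinset (fun _ : Fin 3 => ({1, -1} : Finset ℤ)),
        mode ℓ (fun i => Int.natAbs ((p i : ℤ) + σ i * s i)) y /
          ∏ i, cosCoeff (Int.natAbs ((p i : ℤ) + σ i * s i)) := by
  have hterm : ∀ σ : Fin 3 → ℤ, mode ℓ (fun i => Int.natAbs ((p i : ℤ) + σ i * s i)) y /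
      ∏ i, cosCoeff (Int.natAbs ((p i : ℤ) + σ i * s i)) =
      ∏ i, cosMode ℓ (Int.natAbs ((p i : ℤ) + σ i * s i)) (y i) / cosCoeff (Int.natAbs ((p i : ℤ) + σ i * s i)) := by
    intro σ; rw [mode, ← Finset.prod_div_distrib]
  simp_rw [hterm]
  rw [← Finset.prod_univ_sum (fun _ => ({1, -1} : Finset ℤ))
    (fun i (σ : ℤ) => cosMode ℓ (Int.natAbs ((p i : ℤ) + σ * s i)) (y i) / cosCoeff (Int.natAbs ((p i : ℤ) + σ * s i))),
    ← Finset.prod_mul_distrib, mode, mode, ← Finset.prod_mul_distrib]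
  refine Finset.prod_congr rfl fun i _ => ?_
  rw [Finset.sum_pair (by norm_num), cosMode_mul_cosMode hℓ]
  congr 2
  · congr 2 <;> [skip; skip] <;> (rw [one_mul]; norm_cast)
  · congr 2 <;> (rw [neg_one_mul]; rfl)

/-- A product of modes (times a constant) is integrable on the cell. [folklore] -/
theorem integrableOn_cell_const_mul_mode_mul_mode (hℓ : 0 < ℓ) (c : ℝ) (k q : Fin 3 → ℕ) :
    IntegrableOn (fun y : Space => c * mode ℓ k y * mode ℓ q y) (cell ℓ) := by
  refine Measure.integrableOn_of_bounded (M := |c| * Real.sqrt (2 / ℓ) ^ 3 * Real.sqrt (2 / ℓ) ^ 3) ?_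
    ((continuous_const.mul (continuous_mode ℓ k)).mul (continuous_mode ℓ q)).aestronglyMeasurable ?_
  · rw [volume_cell]; exact ENNReal.pow_ne_top ENNReal.ofReal_ne_top
  · filter_upwards with y
    rw [Real.norm_eq_abs, abs_mul, abs_mul]
    exact mul_le_mul (mul_le_mul_of_nonneg_left (abs_mode_le hℓ k y) (abs_nonneg _))
      (abs_mode_le hℓ q y) (abs_nonneg _) (by positivity)

/-- **The matrix element of `Q₃^{sym}` in the Neumann basis** [FournaisEtAl2024, §6.1]: for `f`
radial, integrable, supported in `B(0,R)`, `R ≤ ℓ/2`, and `p, k, s ∈ ℕ₀³`,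
`∫_{Λ²} u_p(y) f^s(x,y) u_k(x) u_s(y) dx dy
 = ∏ᵢ(c_{pᵢ}c_{sᵢ}/(2√ℓ)) Σ_{σ∈{±1}³} δ_{k,|p+σs|} f̂_c(k)/∏ᵢ c_{|pᵢ+σᵢsᵢ|}`
(`f̂_c(k) = ∫ f ∏cos(kᵢxᵢ) = f̂(k)`), from Lemma 2.5 and the product rule of the modes.
[cite: FournaisEtAl2024, §6.1 (proof of Lemma 2.8, the display after "Using Lemma 2.5 we obtain")] -/
theorem setIntegral_symmetrize_matrix_element (hℓ : 0 < ℓ) {f : Space → ℝ} (hf : Integrable f)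
    (hrad : ∀ x y : Space, ‖x‖ = ‖y‖ → f x = f y) {R : ℝ} (hsupp : ∀ x, R < ‖x‖ → f x = 0)
    (hR : R ≤ ℓ / 2) (p k s : Fin 3 → ℕ) :
    ∫ y in cell ℓ, (∫ x in cell ℓ, symmetrize ℓ f x y * mode ℓ k x) * (mode ℓ p y * mode ℓ s y) =
      (∏ i, cosCoeff (p i) * cosCoeff (s i) / (2 * Real.sqrt ℓ)) *
        ∑ σ ∈ Fintype.piFinset (fun _ : Fin 3 => ({1, -1} : Finset ℤ)),
          (if k = (fun i => Int.natAbs ((p i : ℤ) + σ i * s i)) then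
              ∫ x : Space, f x * ∏ i, Real.cos (waveNumber ℓ (k i) * x i) else 0) /
            ∏ i, cosCoeff (Int.natAbs ((p i : ℤ) + σ i * s i)) := by
  set F : ℝ := ∫ w : Space, f w * ∏ i, Real.cos (waveNumber ℓ (k i) * w i) with hF
  set S := Fintype.piFinset (fun _ : Fin 3 => ({1, -1} : Finset ℤ)) with hS
  -- replace the inner integral on the cell and expand the product of modes
  have hstep : ∀ y ∈ cell ℓ, (∫ x in cell ℓ, symmetrize ℓ f x y * mode ℓ k x) * (mode ℓ p y * mode ℓ s y) =
      ∑ σ ∈ S, (∏ i, cosCoeff (p i) * cosCoeff (s i) / (2 * Real.sqrt ℓ)) /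
          (∏ i, cosCoeff (Int.natAbs ((p i : ℤ) + σ i * s i))) *
        (F * mode ℓ k y * mode ℓ (fun i => Int.natAbs ((p i : ℤ) + σ i * s i)) y) := by
    intro y hy
    rw [setIntegral_symmetrize_mul_mode hℓ hf hrad hsupp hR k hy, mode_mul_mode hℓ, Finset.mul_sum,
      Finset.mul_sum]
    refine Finset.sum_congr rfl fun σ _ => ?_
    rw [← hF]; ring
  rw [setIntegral_congr_fun (measurableSet_cell ℓ) hstep, integral_finsetSum _ fun σ _ =>
    (integrableOn_cell_const_mul_mode_mul_mode hℓ F k _).const_mul _]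
  rw [Finset.mul_sum]
  refine Finset.sum_congr rfl fun σ _ => ?_
  rw [integral_const_mul]
  have h25 : ∫ y in cell ℓ, F * mode ℓ k y * mode ℓ (fun i => Int.natAbs ((p i : ℤ) + σ i * s i)) y =
      if k = (fun i => Int.natAbs ((p i : ℤ) + σ i * s i)) then F else 0 := by
    have : ∀ y, F * mode ℓ k y * mode ℓ (fun i => Int.natAbs ((p i : ℤ) + σ i * s i)) y =
        F * (mode ℓ k y * mode ℓ (fun i => Int.natAbs ((p i : ℤ) + σ i * s i)) y) := fun y => by ring
    simp_rw [this]
    rw [integral_const_mul, setIntegral_cell_mode_mul_mode hℓ]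
    split_ifs <;> simp
  rw [h25]
  ring

end ProductRule

end Literature.MathematicalPhysics.QuantumManyBody.NeumannBox
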